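import Literature.NumberTheory.LFunctions.Zhang2022.RepairLambdaBlock
import Literature.NumberTheory.LFunctions.Zhang2022.KnifeEdgeWallCross
import Literature.NumberTheory.LFunctions.Zhang2022.DetectorMainTermForm

/-!
# Zhang (2022) §18-margin repair rung, programme F-S3 §E (cell landau-siegel, seat p5): the displayed slots of the M2
# Λ-block family HOLD in every world that is a main-order LIMIT of non-negatively weighted discrete Gram data —
# the (B2) pedigree of `LambdaBlockCS` / `LambdaDiagNonneg` (companion of `RepairLambdaBlock`, p464018)

Y. Zhang, *Discrete mean estimates and the Landau–Siegel zero*, arXiv:2211.02515v1 [Zhang2022LandauSiegel] — an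
unrefereed manuscript under adjudication. **WHAT THIS IS NOT: not a claim about Theorems 1–2 of arXiv:2211.02515, about
Landau–Siegel zeros, about a repaired `Margin232`, or about Parity; nothing here asserts (A), Lemma 2.3, or the E-030
dictionary. The programme SEARCHES and TYPES.** `RepairLambdaBlock` (p464018) decides B-multi's sub-class M2 in every model
world `(K, X)` carrying the DISPLAYED slots `KnifeEdge.LambdaDiagNonneg K` and `KnifeEdge.LambdaBlockCS K X` (kind (c)), and
shows the slots' negation on a member (`LambdaBlockIndefinite`, the (c)-door E-085) is exactly the model's closing condition.
This file records, as kernel theorems with NO analytic hypothesis, what it takes for a world to VIOLATE the slots: at a member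
`(u, λ)` the three entries `(𝔅(u), κ_×(u,λ), K_Λ(λ))` must NOT be the limits, along any filter whatsoever, of the normalised
Gram data `(Ξ(F,F), Ξ(F,G), Ξ(G,G))/S` of two value tables under weights `≥ 0` — because such data satisfy
`|Ξ(F,G)|² ≤ Ξ(F,F)·Ξ(G,G)` and `Ξ(G,G) ≥ 0` EXACTLY at every stage (`KnifeEdge.norm_sq_discPolar_le`,
`KnifeEdge.discMean_nonneg`, p459102) and these inequalities pass to limits (`Det.mainOrder_norm_sq_le`, p456255).
In the cell's words (B-multi KILL-CERT v2.4 §1/§8, ls-ref-1 18:13:05Z wording): a derived INDEFINITE block that is a genuine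
main-order limit of the manuscript's discrete form with Lemma-2.3-type weights cannot exist; the (c)-door is a NON-LIMIT
(non-model) main term — whose (A)-world reading is `KnifeEdge.theorem1_of_eMultiLambda_indefinite` (p459168). No premise
B-AH is used or asserted here: the statements are about limits of finite sums.

**Contents.** `lambdaSlotsAt_of_tendsto` (abstract: three real/complex nets with stagewise CS and `K ≥ 0` converging to the
block entries at `(u, λ)` ⇒ `0 ≤ K_Λ(λ) ∧ |κ_×(u,λ)|² ≤ 𝔅(u)·K_Λ(λ)`), `lambdaSlotsAt_of_discreteLimit` (the same with the
nets = Zhang-shaped discrete Gram data `KnifeEdge.discMean` / `KnifeEdge.discPolar` of two value tables per stage, any moduli,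
any characters, any positive scale, weights `≥ 0` eventually), and the family-level corollary `lambdaBlockCS_of_discreteLimits`
(if EVERY member's entries are such limits, `LambdaBlockCS K X` — hence, by `Repair.lambdaDiagNonneg_of_cs`, both slots — hold,
and the M2 verdict of `familyLambdaBlockAll` applies with its binders discharged: `lambdaBlock_verdict_of_discreteLimits`).
References: Zhang, arXiv:2211.02515v1, §2 (2.15)–(2.19), Lemma 2.3, Props 2.4–2.6 p.6 [cite: Zhang2022LandauSiegel, §2
(2.16)–(2.19), Props 2.4–2.6]; cell files B-multi/KILL-draft.md (KILL-CERT v2.4) §1/§8, barrier/REF-E.md E-14.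
«The programme SEARCHES and TYPES; no claim about Landau–Siegel zeros, Theorems 1–2 of arXiv:2211.02515 or a repaired
Margin232 until a kernel theorem says so.»
-/

noncomputable section

open Complex Real Set Filter
open scoped Topology

namespace Literature.NumberTheory.LFunctions.Zhang2022

namespace Repair

open KnifeEdge Skeleton

variable {K : LambdaDiag} {X : LambdaCross} {u u' : ℝ → ℂ} {L : LambdaPiece}

/-- **(B2) for the Λ-block, abstract form.** If along a non-trivial filter three nets `A → 𝔅(u)`, `Kd → K_Λ(λ)` (real) and
`C → κ_×(u,λ)` (complex) satisfy at every late stage the Cauchy–Schwarz shape `‖C‖² ≤ A·Kd` and `0 ≤ Kd`, then both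
displayed slots hold AT THE MEMBER `(u, λ)`: `0 ≤ K_Λ(λ)` and `|κ_×(u,λ)|² ≤ 𝔅(u)·K_Λ(λ)`. Pure limit algebra
(`Det.mainOrder_norm_sq_le` with scale `1`, `ge_of_tendsto`). [cite: Zhang2022LandauSiegel, §2 (2.18)–(2.19), Props 2.4–2.6 p.6] -/
theorem lambdaSlotsAt_of_tendsto {α : Type*} {l : Filter α} [l.NeBot] {A Kd : α → ℝ} {C : α → ℂ}
    (hcs : ∀ᶠ a in l, ‖C a‖ ^ 2 ≤ A a * Kd a) (hK : ∀ᶠ a in l, 0 ≤ Kd a)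
    (hA : Tendsto A l (𝓝 (mainTermForm u u'))) (hKd : Tendsto Kd l (𝓝 (K L)))
    (hC : Tendsto C l (𝓝 (X u u' L))) :
    0 ≤ K L ∧ ‖X u u' L‖ ^ 2 ≤ mainTermForm u u' * K L := by
  refine ⟨ge_of_tendsto hKd hK, ?_⟩
  have hX1 : ∀ᶠ a in l, (0 : ℝ) < (fun _ => (1 : ℝ)) a := Filter.Eventually.of_forall fun _ => one_pos
  refine Det.mainOrder_norm_sq_le (X := fun _ => (1 : ℝ)) (quu := A) (qvv := Kd) (quv := C) hcs hX1 ?_ ?_ ?_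
  · simpa using hA
  · simpa using hKd
  · simpa using hC

/-- **(B2) for the Λ-block, discrete form.** Stage `a` carries a modulus `Dm a`, a real character `χm a`, the shift
parameter `c′`, two value tables `F a` (the in-class piece's polynomial) and `G a` (the Λ-piece's polynomial) over Zhang's
sampled pairs, and a positive scale `S a` (the manuscript: `𝔞𝔓`); the weights `Re 𝔠*·Re ω` are `≥ 0` at late stages
(Lemma 2.3 / Prop. 2.2 (i) would give this — NOT asserted). If the normalised Gram data converge to the block entries at
`(u, λ)` — `Ξ(F)/S → 𝔅(u)`, `Ξ(G)/S → K_Λ(λ)`, `Ξ(F,G)/S → κ_×(u,λ)` — then both slots hold at `(u, λ)`.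
[cite: Zhang2022LandauSiegel, §2 (2.16)–(2.19), Props 2.4–2.6 p.6] -/
theorem lambdaSlotsAt_of_discreteLimit {α : Type*} {l : Filter α} [l.NeBot] (Dm : α → ℕ)
    (χm : (a : α) → DirichletCharacter ℂ (Dm a)) (c' : ℝ) (F G : (a : α) → Chr (Dm a) → ℂ → ℂ) (S : α → ℝ)
    (hw : ∀ᶠ a in l, ∀ i ∈ idx (χm a), 0 ≤ (cstar c' (Dm a) i.1 i.2).re * (omegaW (Dm a) i.2).re)
    (hS : ∀ᶠ a in l, 0 < S a)
    (hA : Tendsto (fun a => KnifeEdge.discMean c' (χm a) (F a) / S a) l (𝓝 (mainTermForm u u')))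
    (hKd : Tendsto (fun a => KnifeEdge.discMean c' (χm a) (G a) / S a) l (𝓝 (K L)))
    (hC : Tendsto (fun a => KnifeEdge.discPolar c' (χm a) (F a) (G a) / (S a : ℂ)) l (𝓝 (X u u' L))) :
    0 ≤ K L ∧ ‖X u u' L‖ ^ 2 ≤ mainTermForm u u' * K L := by
  refine ⟨ge_of_tendsto hKd ?_, ?_⟩
  · filter_upwards [hw, hS] with a ha hSa
    exact div_nonneg (KnifeEdge.discMean_nonneg ha _) hSa.le
  · exact Det.mainOrder_norm_sq_le (X := S) (quu := fun a => KnifeEdge.discMean c' (χm a) (F a))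
      (qvv := fun a => KnifeEdge.discMean c' (χm a) (G a)) (quv := fun a => KnifeEdge.discPolar c' (χm a) (F a) (G a))
      (hw.mono fun a ha => KnifeEdge.norm_sq_discPolar_le ha _ _) hS hA hKd hC

/-- **Family level.** If at EVERY member `(u, λ)` of the class the entries of the world `(K, X)` are such limits (the data may
depend on the member), the slot `LambdaBlockCS K X` holds — hence `LambdaDiagNonneg K` too (`lambdaDiagNonneg_of_cs`).
[cite: Zhang2022LandauSiegel, §2 (2.16)–(2.19), Props 2.4–2.6 p.6] -/
theorem lambdaBlockCS_of_discreteLimits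
    (h : ∀ (u u' : ℝ → ℂ) (L : LambdaPiece), KinkedProfile u u' → u 1 = 0 → L.Admissible →
      ∃ (α : Type) (l : Filter α) (_ : l.NeBot) (A Kd : α → ℝ) (C : α → ℂ),
        (∀ᶠ a in l, ‖C a‖ ^ 2 ≤ A a * Kd a) ∧ (∀ᶠ a in l, 0 ≤ Kd a) ∧
          Tendsto A l (𝓝 (mainTermForm u u')) ∧ Tendsto Kd l (𝓝 (K L)) ∧ Tendsto C l (𝓝 (X u u' L))) :
    LambdaBlockCS K X ∧ LambdaDiagNonneg K := by
  have hcs : LambdaBlockCS K X := by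
    intro u u' L hu hu1 hL
    obtain ⟨α, l, hl, A, Kd, C, h1, h2, h3, h4, h5⟩ := h u u' L hu hu1 hL
    exact (lambdaSlotsAt_of_tendsto h1 h2 h3 h4 h5).2
  exact ⟨hcs, lambdaDiagNonneg_of_cs hcs⟩

/-- … and then the M2 verdict applies with its binders discharged: no member has a negative model constant.
[cite: Zhang2022LandauSiegel, §7 Prop 7.1 (7.2)] -/
theorem lambdaBlock_verdict_of_discreteLimits
    (h : ∀ (u u' : ℝ → ℂ) (L : LambdaPiece), KinkedProfile u u' → u 1 = 0 → L.Admissible →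
      ∃ (α : Type) (l : Filter α) (_ : l.NeBot) (A Kd : α → ℝ) (C : α → ℂ),
        (∀ᶠ a in l, ‖C a‖ ^ 2 ≤ A a * Kd a) ∧ (∀ᶠ a in l, 0 ≤ Kd a) ∧
          Tendsto A l (𝓝 (mainTermForm u u')) ∧ Tendsto Kd l (𝓝 (K L)) ∧ Tendsto C l (𝓝 (X u u' L)))
    {d : LambdaDesign} (hd : d.InClass) : ¬ (lambdaBlockMainTerm K X d.u d.u' d.L d.c < 0) :=
  familyLambdaBlock_verdict_of_cs (lambdaBlockCS_of_discreteLimits h).1 hd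

end Repair

end Literature.NumberTheory.LFunctions.Zhang2022
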